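import Mathlib.Analysis.Calculus.Deriv.ZPow
import Mathlib.Analysis.Calculus.MeanValue
import Literature.Analysis.Fourier.TelescopingLowPassPieces
import HarnessLib

/-!
# Symbol bounds for the low-pass cascade and the quotient `(1 − G)/a`

Topic `Literature/Analysis/Fourier`.  Continuation of `TelescopingLowPassPieces.lean` (Buchholz,
J. Funct. Anal. 275 (2018), Thm 2.3 (2.26)/Lemma 5.1 (5.3); Bauerschmidt 2013, §3.3–§3.4): uniform
("symbol-type") estimates of all orders for

* the CASCADE `J_k = Π_{i≤k} G_i` (`cascade`): `|J_k^{(i)}(a)| ≤ K_i (t_k²/B)^i` with `K_i` independent of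
  `k, L, B` (`exists_abs_iteratedDeriv_cascade_le`; the induction over `k` uses the scale ratio
  `t_{k-1}/t_k ≤ 2/3`), and with decay `min(1, (t_k² a/B)^{-j})` (`exists_abs_iteratedDeriv_cascade_le_decay`);
* the QUOTIENT `h_k = (1 − G_k)/a` (`quot`): the bulk bound `|h_k^{(i)}(a)| ≤ sup |G_k^{(i+1)}| ≤ H (t_k²/B)^{i+1}`
  for `t_k² a ≤ B` (a mean-value argument on `a^{i+1} h^{(i)}`), the tail bound `|h_k^{(i)}(a)| ≤ H a^{-i-1}`
  for `t_k² a ≥ B` (Leibniz on `(1 − G) · a^{-1}`), combined as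
  `a^i |h_k^{(i)}(a)| ≤ H min(t_k²/B, 1/a)` (`exists_abs_iteratedDeriv_quot_le`).

Everything is proved; no named facts.

## References
* S. Buchholz, *Finite range decomposition for Gaussian measures with improved regularity*,
  J. Funct. Anal. 275 (2018), Lemma 5.1 (5.3), Thm 2.3 (2.26) [Buchholz2016].
* R. Bauerschmidt, Probab. Theory Relat. Fields 157 (2013), §3.3–§3.4 [Bauerschmidt2013].
-/

noncomputable section

open Finset Polynomial
open scoped Real

namespace Literature.Analysis.Fourier

/-! ## Tools: Leibniz bound, polynomial calculus -/

/-- Leibniz bound for the iterated derivative of a product of smooth real functions. [folklore] -/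
private theorem abs_iteratedDeriv_mul_le {f g : ℝ → ℝ} (hf : ∀ n : ℕ, ContDiff ℝ n f) (hg : ∀ n : ℕ, ContDiff ℝ n g)
    (n : ℕ) (x : ℝ) :
    |iteratedDeriv n (fun y => f y * g y) x| ≤
      ∑ i ∈ Finset.range (n + 1), (n.choose i : ℝ) * |iteratedDeriv i f x| * |iteratedDeriv (n - i) g x| := by
  have h := norm_iteratedFDeriv_mul_le (hf n) (hg n) x (n := n) le_rfl
  rw [← Real.norm_eq_abs, ← norm_iteratedFDeriv_eq_norm_iteratedDeriv]
  refine h.trans (le_of_eq (sum_congr rfl fun i _ => ?_))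
  rw [norm_iteratedFDeriv_eq_norm_iteratedDeriv, norm_iteratedFDeriv_eq_norm_iteratedDeriv, Real.norm_eq_abs,
    Real.norm_eq_abs]

/-- Polynomial functions are smooth. [folklore] -/
private theorem contDiff_polyEval (P : ℝ[X]) {n : WithTop ℕ∞} : ContDiff ℝ n (fun x => P.eval x) := by
  have h := P.contDiff_aeval (𝕜 := ℝ) n
  simpa only [Polynomial.coe_aeval_eq_eval] using h

/-- Iterated derivatives of polynomial functions. [folklore] -/
private theorem iteratedDeriv_polyEval (P : ℝ[X]) :
    ∀ i : ℕ, iteratedDeriv i (fun x => P.eval x) = fun x => (derivative^[i] P).eval x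
  | 0 => by simp
  | i + 1 => by
    rw [iteratedDeriv_succ, iteratedDeriv_polyEval P i, Function.iterate_succ_apply']
    funext x
    exact Polynomial.deriv _

/-- The low-pass factors are smooth. [cite: Buchholz2016, Lemma 5.1 (proof)] -/
theorem contDiff_lp (B : ℝ) (L i : ℕ) (n : ℕ) : ContDiff ℝ n (lp B L i) := contDiff_lowPass _ _ _

/-- The cascade is a polynomial function, hence smooth. [cite: Buchholz2016, §3 (p. 9)] -/
theorem contDiff_cascade (B : ℝ) (L k : ℕ) (n : ℕ) : ContDiff ℝ n (cascade B L k) := by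
  have : cascade B L k = fun a => (cascadePoly B L k).eval a := funext fun a => (cascadePoly_eval B L k a).symm
  rw [this]; exact contDiff_polyEval _

/-- The quotient is a polynomial function, hence smooth. [cite: Buchholz2016, §3 (p. 9)] -/
theorem contDiff_quot (B : ℝ) (L i : ℕ) (n : ℕ) : ContDiff ℝ n (fun a => (quot B L i).eval a) :=
  contDiff_polyEval _

/-- `J_0 = 1` has vanishing derivatives: `|J_0^{(i)}| ≤ [i = 0]`. [cite: Bauerschmidt2013, §2.1] -/
theorem abs_iteratedDeriv_cascade_zero_le (B : ℝ) (L i : ℕ) (a : ℝ) {K : ℝ} (hK : 0 ≤ K) (h1 : i = 0 → 1 ≤ K) :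
    |iteratedDeriv i (cascade B L 0) a| ≤ K := by
  have : cascade B L 0 = fun _ => (1 : ℝ) := funext fun a => cascade_zero B L a
  rw [this, iteratedDeriv_const]
  split_ifs with h
  · rw [abs_one]; exact h1 h
  · rw [abs_zero]; exact hK

/-! ## The symbol estimate for the low-pass factors at our scales -/

/-- The symbol estimate of `ChebyshevLowPassBumps` specialised to `G_i = lowPass B m_i t_i`:
`|G_i^{(n)}(a)| ≤ C (t_i²/B)^n min(1, (t_i² a/B)^{-j})` on `(0, 2B]`. [cite: Buchholz2016, Lemma 5.1 (5.3)] -/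
theorem exists_abs_iteratedDeriv_lp_le (n j : ℕ) : ∃ C, 0 ≤ C ∧ ∀ B : ℝ, 0 < B → ∀ L i : ℕ, ∀ a : ℝ,
    0 < a → a ≤ 2 * B → |iteratedDeriv n (lp B L i) a| ≤
      C * ((scaleT L i : ℝ) ^ 2 / B) ^ n * min 1 ((((scaleT L i : ℝ) ^ 2 * a / B))⁻¹ ^ j) := by
  obtain ⟨C, hC0, hC⟩ := exists_abs_iteratedDeriv_lowPass_le n j
  exact ⟨C, hC0, fun B hB L i a ha0 ha =>
    hC B hB (scaleM L i) (scaleT L i) (one_le_scaleM L i) (two_le_scaleT L i) (scaleM_le_scaleT L i) a ha0 ha⟩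

/-- `|G_i(a)| ≤ 1` on `(0, 2B]`. [cite: Buchholz2016, Lemma 5.1 (5.2)] -/
theorem abs_lp_le_one {B : ℝ} (hB : 0 < B) (L i : ℕ) {a : ℝ} (ha0 : 0 < a) (ha : a ≤ 2 * B) : |lp B L i a| ≤ 1 := by
  have h := lp_mem_Icc hB L i ha0.le (by linarith)
  rw [abs_of_nonneg h.1]; exact h.2

/-- `|J_k(a)| ≤ 1` on `(0, 2B]`. [cite: Bauerschmidt2013, §2.1] -/
theorem abs_cascade_le_one {B : ℝ} (hB : 0 < B) (L k : ℕ) {a : ℝ} (ha0 : 0 < a) (ha : a ≤ 2 * B) :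
    |cascade B L k a| ≤ 1 := by
  have h := cascade_mem_Icc hB L k ha0.le (by linarith)
  rw [abs_of_nonneg h.1]; exact h.2

/-- The squared scale ratio is at most `4/9` (`L ≥ 5`, `k ≥ 1`). [cite: Bauerschmidt2013, §3.2] -/
theorem scaleT_sq_ratio_le {L : ℕ} (hL : 5 ≤ L) {k : ℕ} (hk : 1 ≤ k) :
    ((scaleT L k : ℝ) ^ 2) / ((scaleT L (k + 1) : ℝ) ^ 2) ≤ 4 / 9 := by
  have h := three_mul_scaleT_le L k hL hk
  have h' : 3 * (scaleT L k : ℝ) ≤ 2 * (scaleT L (k + 1) : ℝ) := by exact_mod_cast h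
  have hpos : (0 : ℝ) < scaleT L (k + 1) := by exact_mod_cast (show 0 < scaleT L (k + 1) by
    have := two_le_scaleT L (k + 1); omega)
  rw [div_le_div_iff₀ (by positivity) (by norm_num)]
  have h0 : (0 : ℝ) ≤ scaleT L k := Nat.cast_nonneg _
  nlinarith

/-! ## The cascade: symbol bounds of all orders, uniformly in `k` -/

/-- **Symbol bound for the cascade, no decay**: for every `n` there is `K` with
`|J_k^{(n)}(a)| ≤ K (t_k²/B)^n` for all `B > 0`, `L ≥ 5`, `k ≥ 1`, `0 < a ≤ 2B`.
[cite: Bauerschmidt2013, §3.4 (3.23); Buchholz2016, Lemma 5.1 (5.3)] -/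
theorem exists_abs_iteratedDeriv_cascade_le (n : ℕ) : ∃ K, 0 ≤ K ∧ ∀ B : ℝ, 0 < B → ∀ L : ℕ, 5 ≤ L →
    ∀ k : ℕ, 1 ≤ k → ∀ a : ℝ, 0 < a → a ≤ 2 * B →
      |iteratedDeriv n (cascade B L k) a| ≤ K * ((scaleT L k : ℝ) ^ 2 / B) ^ n := by
  induction n using Nat.strong_induction_on with
  | _ n IH =>
    rcases Nat.eq_zero_or_pos n with hn0 | hnpos
    · subst hn0
      refine ⟨1, zero_le_one, fun B hB L _ k _ a ha0 ha => ?_⟩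
      rw [iteratedDeriv_zero, pow_zero, mul_one]
      exact abs_cascade_le_one hB L k ha0 ha
    -- constants for the lower orders (with `K'_0 = 1`) and for the low-pass factors
    have hIH : ∀ i : ℕ, ∃ K, 0 ≤ K ∧ (i < n → ∀ B : ℝ, 0 < B → ∀ L : ℕ, 5 ≤ L → ∀ k : ℕ, 1 ≤ k → ∀ a : ℝ,
        0 < a → a ≤ 2 * B → |iteratedDeriv i (cascade B L k) a| ≤ K * ((scaleT L k : ℝ) ^ 2 / B) ^ i) := by
      intro i
      by_cases hi : i < n
      · obtain ⟨K, hK0, hK⟩ := IH i hi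
        exact ⟨K, hK0, fun _ => hK⟩
      · exact ⟨0, le_rfl, fun h => absurd h hi⟩
    choose K0 hK00 hK0 using hIH
    have hGc : ∀ i : ℕ, ∃ C, 0 ≤ C ∧ ∀ B : ℝ, 0 < B → ∀ L i' : ℕ, ∀ a : ℝ, 0 < a → a ≤ 2 * B →
        |iteratedDeriv i (lp B L i') a| ≤ C * ((scaleT L i' : ℝ) ^ 2 / B) ^ i := by
      intro i
      obtain ⟨C, hC0, hC⟩ := exists_abs_iteratedDeriv_lp_le i 0
      refine ⟨C, hC0, fun B hB L i' a ha0 ha => (hC B hB L i' a ha0 ha).trans ?_⟩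
      rw [pow_zero, min_self, mul_one]
    choose C hC0 hC using hGc
    -- `K' i = K0 i` for `0 < i < n`, `K' 0 = 1`
    set K' : ℕ → ℝ := fun i => if i = 0 then 1 else K0 i with hK'
    have hK'0 : ∀ i, 0 ≤ K' i := fun i => by simp only [hK']; split_ifs; exacts [zero_le_one, hK00 i]
    have hK'b : ∀ i, i < n → ∀ B : ℝ, 0 < B → ∀ L : ℕ, 5 ≤ L → ∀ k : ℕ, 1 ≤ k → ∀ a : ℝ, 0 < a → a ≤ 2 * B →
        |iteratedDeriv i (cascade B L k) a| ≤ K' i * ((scaleT L k : ℝ) ^ 2 / B) ^ i := by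
      intro i hi B hB L hL k hk a ha0 ha
      simp only [hK']
      split_ifs with h0
      · subst h0; rw [iteratedDeriv_zero, pow_zero, mul_one]; exact abs_cascade_le_one hB L k ha0 ha
      · exact hK0 i hi B hB L hL k hk a ha0 ha
    set ρ : ℝ := 4 / 9 with hρ
    set S : ℝ := ∑ i ∈ Finset.range n, (n.choose i : ℝ) * K' i * C (n - i) * ρ ^ i with hS
    have hS0 : 0 ≤ S := sum_nonneg fun i _ => by
      have := hK'0 i; have := hC0 (n - i); positivity
    have hρn : ρ ^ n < 1 := pow_lt_one₀ (by norm_num) (by norm_num) (by omega)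
    set K : ℝ := S / (1 - ρ ^ n) with hKdef
    have hK0' : 0 ≤ K := div_nonneg hS0 (by linarith)
    have hKS : S + K * ρ ^ n = K := by
      have hne : (1 - ρ ^ n) ≠ 0 := (sub_pos.2 hρn).ne'
      simp only [hKdef]; field_simp; ring
    have hCn : C n ≤ K := by
      -- the `i = 0` term of `S` is `C n`
      have h1 : (n.choose 0 : ℝ) * K' 0 * C (n - 0) * ρ ^ 0 ≤ S :=
        Finset.single_le_sum (f := fun i => (n.choose i : ℝ) * K' i * C (n - i) * ρ ^ i)
          (fun i _ => by have := hK'0 i; have := hC0 (n - i); positivity) (Finset.mem_range.2 hnpos)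
      have h0 : (n.choose 0 : ℝ) * K' 0 * C (n - 0) * ρ ^ 0 = C n := by simp [hK']
      have h2 : S ≤ K := by
        rw [← hKS]; have : 0 ≤ K * ρ ^ n := by positivity
        linarith
      linarith
    refine ⟨K, hK0', fun B hB L hL k hk a ha0 ha => ?_⟩
    -- induction on `k ≥ 1` with the fixed constant `K`
    induction k with
    | zero => omega
    | succ k ihk =>
      rcases Nat.eq_zero_or_pos k with hk0 | hkpos
      · -- `J_1 = G_1`
        subst hk0
        have : cascade B L 1 = lp B L 1 := by
          funext a'; rw [show (1 : ℕ) = 0 + 1 from rfl, cascade_succ, cascade_zero, one_mul]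
        rw [this]
        calc |iteratedDeriv n (lp B L 1) a| ≤ C n * ((scaleT L 1 : ℝ) ^ 2 / B) ^ n := hC n B hB L 1 a ha0 ha
          _ ≤ K * ((scaleT L (0 + 1) : ℝ) ^ 2 / B) ^ n := mul_le_mul_of_nonneg_right hCn (by positivity)
      · -- `J_{k+1} = J_k · G_{k+1}`
        have hprev := ihk hkpos
        have hfun : cascade B L (k + 1) = fun a' => cascade B L k a' * lp B L (k + 1) a' :=
          funext fun a' => cascade_succ B L k a'
        rw [hfun]
        have hL' := abs_iteratedDeriv_mul_le (contDiff_cascade B L k) (contDiff_lp B L (k + 1)) n a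
        refine hL'.trans ?_
        rw [Finset.sum_range_succ]
        -- scale ratio
        set T1 : ℝ := (scaleT L k : ℝ) ^ 2 / B with hT1
        set T2 : ℝ := (scaleT L (k + 1) : ℝ) ^ 2 / B with hT2
        have htpos : (0 : ℝ) < scaleT L (k + 1) := by
          exact_mod_cast (show 0 < scaleT L (k + 1) by have := two_le_scaleT L (k + 1); omega)
        have hT2pos : 0 < T2 := by rw [hT2]; exact div_pos (pow_pos htpos 2) hB
        have hT1nn : 0 ≤ T1 := by positivity
        have hratio : T1 ≤ ρ * T2 := by
          have h := scaleT_sq_ratio_le hL hkpos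
          rw [hT1, hT2, hρ]
          rw [div_le_iff₀ (pow_pos htpos 2)] at h
          have hB' : 0 < B⁻¹ := inv_pos.2 hB
          calc (scaleT L k : ℝ) ^ 2 / B = (scaleT L k : ℝ) ^ 2 * B⁻¹ := div_eq_mul_inv _ _
            _ ≤ (4 / 9 * (scaleT L (k + 1) : ℝ) ^ 2) * B⁻¹ := mul_le_mul_of_nonneg_right h hB'.le
            _ = 4 / 9 * ((scaleT L (k + 1) : ℝ) ^ 2 / B) := by ring
        have hT1le : ∀ i : ℕ, T1 ^ i ≤ ρ ^ i * T2 ^ i := fun i => by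
          rw [← mul_pow]; exact pow_le_pow_left₀ hT1nn hratio i
        -- the terms `i < n`
        have hterms : ∀ i ∈ Finset.range n, (n.choose i : ℝ) * |iteratedDeriv i (cascade B L k) a| *
            |iteratedDeriv (n - i) (lp B L (k + 1)) a| ≤ (n.choose i : ℝ) * K' i * C (n - i) * ρ ^ i * T2 ^ n := by
          intro i hi
          rw [Finset.mem_range] at hi
          have h1 := hK'b i hi B hB L hL k hkpos a ha0 ha
          have h2 := hC (n - i) B hB L (k + 1) a ha0 ha
          rw [← hT1] at h1
          rw [← hT2] at h2
          calc (n.choose i : ℝ) * |iteratedDeriv i (cascade B L k) a| * |iteratedDeriv (n - i) (lp B L (k + 1)) a|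
              ≤ (n.choose i : ℝ) * (K' i * T1 ^ i) * (C (n - i) * T2 ^ (n - i)) := by
                refine mul_le_mul (mul_le_mul_of_nonneg_left h1 (Nat.cast_nonneg _)) h2 (abs_nonneg _) ?_
                have := hK'0 i; positivity
            _ ≤ (n.choose i : ℝ) * (K' i * (ρ ^ i * T2 ^ i)) * (C (n - i) * T2 ^ (n - i)) := by
                have := hK'0 i; have := hC0 (n - i)
                gcongr
                exact hT1le i
            _ = (n.choose i : ℝ) * K' i * C (n - i) * ρ ^ i * (T2 ^ i * T2 ^ (n - i)) := by ring
            _ = (n.choose i : ℝ) * K' i * C (n - i) * ρ ^ i * T2 ^ n := by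
                rw [← pow_add, show i + (n - i) = n by omega]
        -- the top term `i = n`
        have htop : (n.choose n : ℝ) * |iteratedDeriv n (cascade B L k) a| * |iteratedDeriv (n - n) (lp B L (k + 1)) a|
            ≤ K * ρ ^ n * T2 ^ n := by
          rw [Nat.choose_self, Nat.cast_one, one_mul, Nat.sub_self, iteratedDeriv_zero]
          calc |iteratedDeriv n (cascade B L k) a| * |lp B L (k + 1) a| ≤ K * T1 ^ n * 1 :=
                mul_le_mul hprev (abs_lp_le_one hB L (k + 1) ha0 ha) (abs_nonneg _) (by positivity)
            _ ≤ K * (ρ ^ n * T2 ^ n) * 1 := by gcongr; exact hT1le n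
            _ = K * ρ ^ n * T2 ^ n := by ring
        calc ∑ i ∈ Finset.range n, (n.choose i : ℝ) * |iteratedDeriv i (cascade B L k) a| *
                |iteratedDeriv (n - i) (lp B L (k + 1)) a| +
              (n.choose n : ℝ) * |iteratedDeriv n (cascade B L k) a| * |iteratedDeriv (n - n) (lp B L (k + 1)) a|
            ≤ ∑ i ∈ Finset.range n, (n.choose i : ℝ) * K' i * C (n - i) * ρ ^ i * T2 ^ n + K * ρ ^ n * T2 ^ n :=
              add_le_add (sum_le_sum hterms) htop
          _ = (S + K * ρ ^ n) * T2 ^ n := by rw [hS, add_mul, Finset.sum_mul]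
          _ = K * T2 ^ n := by rw [hKS]

/-- **Symbol bound for the cascade with decay**: for all `n, j` there is `K` with
`|J_k^{(n)}(a)| ≤ K (t_k²/B)^n min(1, (t_k² a/B)^{-j})` for `B > 0`, `L ≥ 5`, `k ≥ 1`, `0 < a ≤ 2B`
(the decay comes from the last factor `G_k`). [cite: Bauerschmidt2013, §3.4 (3.23); Buchholz2016, Lemma 5.1 (5.3)] -/
theorem exists_abs_iteratedDeriv_cascade_le_decay (n j : ℕ) : ∃ K, 0 ≤ K ∧ ∀ B : ℝ, 0 < B → ∀ L : ℕ, 5 ≤ L →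
    ∀ k : ℕ, 1 ≤ k → ∀ a : ℝ, 0 < a → a ≤ 2 * B →
      |iteratedDeriv n (cascade B L k) a| ≤
        K * ((scaleT L k : ℝ) ^ 2 / B) ^ n * min 1 ((((scaleT L k : ℝ) ^ 2 * a / B))⁻¹ ^ j) := by
  have hJ : ∀ i : ℕ, ∃ K, 0 ≤ K ∧ ∀ B : ℝ, 0 < B → ∀ L : ℕ, 5 ≤ L → ∀ k : ℕ, 1 ≤ k → ∀ a : ℝ, 0 < a → a ≤ 2 * B →
      |iteratedDeriv i (cascade B L k) a| ≤ K * ((scaleT L k : ℝ) ^ 2 / B) ^ i :=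
    fun i => exists_abs_iteratedDeriv_cascade_le i
  choose K0 hK00 hK0 using hJ
  have hG : ∀ i : ℕ, ∃ C, 0 ≤ C ∧ ∀ B : ℝ, 0 < B → ∀ L i' : ℕ, ∀ a : ℝ, 0 < a → a ≤ 2 * B →
      |iteratedDeriv i (lp B L i') a| ≤ C * ((scaleT L i' : ℝ) ^ 2 / B) ^ i *
        min 1 ((((scaleT L i' : ℝ) ^ 2 * a / B))⁻¹ ^ j) := fun i => exists_abs_iteratedDeriv_lp_le i j
  choose C hC0 hC using hG
  set K' : ℕ → ℝ := fun i => if i = 0 then 1 else K0 i with hK'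
  have hK'0 : ∀ i, 0 ≤ K' i := fun i => by simp only [hK']; split_ifs; exacts [zero_le_one, hK00 i]
  -- bound for `J_{k-1}` including `k - 1 = 0`
  have hK'b : ∀ i : ℕ, ∀ B : ℝ, 0 < B → ∀ L : ℕ, 5 ≤ L → ∀ k : ℕ, ∀ a : ℝ, 0 < a → a ≤ 2 * B →
      |iteratedDeriv i (cascade B L k) a| ≤ K' i * ((scaleT L k : ℝ) ^ 2 / B) ^ i := by
    intro i B hB L hL k a ha0 ha
    simp only [hK']
    split_ifs with h0
    · subst h0; rw [iteratedDeriv_zero, pow_zero, mul_one]; exact abs_cascade_le_one hB L k ha0 ha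
    · rcases Nat.eq_zero_or_pos k with hk | hk
      · subst hk
        exact abs_iteratedDeriv_cascade_zero_le B L i a (mul_nonneg (hK00 i) (by positivity)) fun h => absurd h h0
      · exact hK0 i B hB L hL k hk a ha0 ha
  set K : ℝ := ∑ i ∈ Finset.range (n + 1), (n.choose i : ℝ) * K' i * C (n - i) with hKdef
  refine ⟨K, sum_nonneg fun i _ => by have := hK'0 i; have := hC0 (n - i); positivity,
    fun B hB L hL k hk a ha0 ha => ?_⟩
  obtain ⟨k', rfl⟩ : ∃ k', k = k' + 1 := ⟨k - 1, by omega⟩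
  have hfun : cascade B L (k' + 1) = fun a' => cascade B L k' a' * lp B L (k' + 1) a' :=
    funext fun a' => cascade_succ B L k' a'
  rw [hfun]
  refine (abs_iteratedDeriv_mul_le (contDiff_cascade B L k') (contDiff_lp B L (k' + 1)) n a).trans ?_
  set T1 : ℝ := (scaleT L k' : ℝ) ^ 2 / B with hT1
  set T2 : ℝ := (scaleT L (k' + 1) : ℝ) ^ 2 / B with hT2
  set D : ℝ := min 1 ((((scaleT L (k' + 1) : ℝ) ^ 2 * a / B))⁻¹ ^ j) with hD
  have hD0 : 0 ≤ D := le_min zero_le_one (by positivity)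
  have hT1nn : 0 ≤ T1 := by positivity
  have hT12 : T1 ≤ T2 := by
    rw [hT1, hT2]
    refine div_le_div_of_nonneg_right (pow_le_pow_left₀ (Nat.cast_nonneg _) ?_ 2) hB.le
    rcases Nat.eq_zero_or_pos k' with hk0 | hk0
    · subst hk0
      have h0 : scaleT L 0 = 2 := by norm_num [scaleT]
      exact_mod_cast (show scaleT L 0 ≤ scaleT L (0 + 1) by rw [h0]; exact two_le_scaleT L _)
    · have h := three_mul_scaleT_le L k' hL hk0
      exact_mod_cast (show scaleT L k' ≤ scaleT L (k' + 1) by omega)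
  have hterms : ∀ i ∈ Finset.range (n + 1), (n.choose i : ℝ) * |iteratedDeriv i (cascade B L k') a| *
      |iteratedDeriv (n - i) (lp B L (k' + 1)) a| ≤ (n.choose i : ℝ) * K' i * C (n - i) * (T2 ^ n * D) := by
    intro i hi
    rw [Finset.mem_range] at hi
    have h1 := hK'b i B hB L hL k' a ha0 ha
    have h2 := hC (n - i) B hB L (k' + 1) a ha0 ha
    rw [← hT1] at h1
    rw [← hT2, ← hD] at h2
    calc (n.choose i : ℝ) * |iteratedDeriv i (cascade B L k') a| * |iteratedDeriv (n - i) (lp B L (k' + 1)) a|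
        ≤ (n.choose i : ℝ) * (K' i * T1 ^ i) * (C (n - i) * T2 ^ (n - i) * D) := by
          refine mul_le_mul (mul_le_mul_of_nonneg_left h1 (Nat.cast_nonneg _)) h2 (abs_nonneg _) ?_
          have := hK'0 i; positivity
      _ ≤ (n.choose i : ℝ) * (K' i * T2 ^ i) * (C (n - i) * T2 ^ (n - i) * D) := by
          have := hK'0 i; have := hC0 (n - i)
          have := pow_le_pow_left₀ hT1nn hT12 i
          gcongr
      _ = (n.choose i : ℝ) * K' i * C (n - i) * ((T2 ^ i * T2 ^ (n - i)) * D) := by ring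
      _ = (n.choose i : ℝ) * K' i * C (n - i) * (T2 ^ n * D) := by rw [← pow_add, show i + (n - i) = n by omega]
  refine (sum_le_sum hterms).trans (le_of_eq ?_)
  rw [← Finset.sum_mul, ← hKdef]; ring

/-! ## The quotient `h_k = (1 − G_k)/a`: bulk and tail bounds -/

/-- `X · h_i = 1 − G_i`. [cite: Buchholz2016, §3 (p. 9)] -/
theorem X_mul_quot (B : ℝ) (L i : ℕ) : X * quot B L i = 1 - lpPoly B L i := by
  rw [mul_comm]; exact quot_mul_X B L i

/-- The derivative identity behind the bulk bound: for `i ≥ 0` and all `ξ`,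
`(d/dξ)[ξ^{i+1} h^{(i)}(ξ)] = −ξ^i G^{(i+1)}(ξ)`. [cite: Buchholz2016, Lemma 5.1 (proof)] -/
theorem hasDerivAt_pow_mul_quotDeriv (B : ℝ) (L k i : ℕ) (ξ : ℝ) :
    HasDerivAt (fun x => x ^ (i + 1) * (derivative^[i] (quot B L k)).eval x)
      (-(ξ ^ i * (derivative^[i + 1] (lpPoly B L k)).eval ξ)) ξ := by
  set P : ℝ[X] := X ^ (i + 1) * derivative^[i] (quot B L k) with hP
  have h := P.hasDerivAt ξ
  have hfun : (fun x => x ^ (i + 1) * (derivative^[i] (quot B L k)).eval x) = fun x => P.eval x := by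
    funext x; rw [hP, eval_mul, eval_pow, eval_X]
  rw [hfun]
  refine h.congr_deriv ?_
  -- compute the derivative polynomial
  have hkey : derivative^[i + 1] (quot B L k * X) = -(derivative^[i + 1] (lpPoly B L k)) := by
    rw [quot_mul_X, iterate_derivative_sub, Function.iterate_succ_apply, derivative_one, iterate_derivative_zero,
      zero_sub]
  rw [Polynomial.iterate_derivative_mul_X, Nat.add_sub_cancel] at hkey
  have h2 := congrArg (eval ξ) hkey
  rw [eval_add, eval_mul, eval_X, eval_smul, eval_neg, nsmul_eq_mul] at h2
  rw [hP, derivative_mul, derivative_X_pow, eval_add, eval_mul, eval_mul, eval_mul, eval_C, eval_pow, eval_X, eval_pow,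
    eval_X, Nat.add_sub_cancel, ← Function.iterate_succ_apply' derivative]
  push_cast at h2 ⊢
  have : ξ ^ (i + 1) = ξ ^ i * ξ := pow_succ ξ i
  rw [this]
  linear_combination ξ ^ i * h2

/-- **Bulk bound for the quotient** (mean-value form): for `0 < a` there is `ξ ∈ (0, a)` with
`|h_k^{(i)}(a)| ≤ |G_k^{(i+1)}(ξ)|`. [cite: Buchholz2016, Lemma 5.1 (5.3)] -/
theorem exists_abs_iteratedDeriv_quot_le_abs (B : ℝ) (L k i : ℕ) {a : ℝ} (ha : 0 < a) :
    ∃ ξ ∈ Set.Ioo 0 a, |iteratedDeriv i (fun x => (quot B L k).eval x) a| ≤ |iteratedDeriv (i + 1) (lp B L k) ξ| := by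
  set ψ : ℝ → ℝ := fun x => x ^ (i + 1) * (derivative^[i] (quot B L k)).eval x with hψ
  have hψd : ∀ x, HasDerivAt ψ (-(x ^ i * (derivative^[i + 1] (lpPoly B L k)).eval x)) x :=
    fun x => hasDerivAt_pow_mul_quotDeriv B L k i x
  obtain ⟨ξ, hξ, hslope⟩ := exists_hasDerivAt_eq_slope ψ (fun x => -(x ^ i * (derivative^[i + 1] (lpPoly B L k)).eval x))
    ha (fun x _ => (hψd x).continuousAt.continuousWithinAt) (fun x _ => hψd x)
  refine ⟨ξ, hξ, ?_⟩
  have hψ0 : ψ 0 = 0 := by simp [hψ]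
  rw [hψ0, sub_zero, sub_zero] at hslope
  -- `ψ a = a · ψ'(ξ)`
  have hψa : ψ a = a * (-(ξ ^ i * (derivative^[i + 1] (lpPoly B L k)).eval ξ)) := by
    rw [hslope]; field_simp
  rw [iteratedDeriv_polyEval]
  have hG : iteratedDeriv (i + 1) (lp B L k) ξ = (derivative^[i + 1] (lpPoly B L k)).eval ξ := by
    have : lp B L k = fun x => (lpPoly B L k).eval x := funext fun x => (lpPoly_eval B L k x).symm
    rw [this, iteratedDeriv_polyEval]
  rw [hG]
  simp only
  have hmain : a ^ (i + 1) * (derivative^[i] (quot B L k)).eval a = a * (-(ξ ^ i * (derivative^[i + 1] (lpPoly B L k)).eval ξ)) :=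
    hψa
  have hξa : ξ ^ i ≤ a ^ i := pow_le_pow_left₀ hξ.1.le hξ.2.le i
  have hai : 0 < a ^ i := pow_pos ha i
  -- `|Q| = a ξ^i |G'| / a^{i+1} ≤ |G'|`
  have : |(derivative^[i] (quot B L k)).eval a| * a ^ (i + 1) = a * ξ ^ i * |(derivative^[i + 1] (lpPoly B L k)).eval ξ| := by
    have h := congrArg (fun x => |x|) hmain
    simp only [abs_mul, abs_neg, abs_pow, abs_of_pos ha, abs_of_pos hξ.1] at h
    linarith [h]
  rw [pow_succ] at this
  have h2 : |(derivative^[i] (quot B L k)).eval a| * a ^ i = ξ ^ i * |(derivative^[i + 1] (lpPoly B L k)).eval ξ| := by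
    have h3 : (|(derivative^[i] (quot B L k)).eval a| * a ^ i) * a = (ξ ^ i * |(derivative^[i + 1] (lpPoly B L k)).eval ξ|) * a := by
      linarith [this]
    exact mul_right_cancel₀ ha.ne' h3
  nlinarith [abs_nonneg ((derivative^[i + 1] (lpPoly B L k)).eval ξ), abs_nonneg ((derivative^[i] (quot B L k)).eval a)]

/-- **Bulk symbol bound for the quotient**: for every `i` there is `H` with
`|h_k^{(i)}(a)| ≤ H (t_k²/B)^{i+1}` for `0 < a ≤ 2B`. [cite: Buchholz2016, Lemma 5.1 (5.3)] -/
theorem exists_abs_iteratedDeriv_quot_le_bulk (i : ℕ) : ∃ H, 0 ≤ H ∧ ∀ B : ℝ, 0 < B → ∀ L k : ℕ, ∀ a : ℝ,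
    0 < a → a ≤ 2 * B → |iteratedDeriv i (fun x => (quot B L k).eval x) a| ≤ H * ((scaleT L k : ℝ) ^ 2 / B) ^ (i + 1) := by
  obtain ⟨C, hC0, hC⟩ := exists_abs_iteratedDeriv_lp_le (i + 1) 0
  refine ⟨C, hC0, fun B hB L k a ha0 ha => ?_⟩
  obtain ⟨ξ, hξ, hle⟩ := exists_abs_iteratedDeriv_quot_le_abs B L k i ha0
  refine hle.trans ((hC B hB L k ξ hξ.1 (by linarith [hξ.2])).trans ?_)
  rw [pow_zero, min_self, mul_one]

/-- Iterated derivatives of `a ↦ a^{-1}` on `(0, ∞)`: `|∂^n a^{-1}| = n! a^{-n-1}`. [folklore] -/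
private theorem abs_iteratedDeriv_inv (n : ℕ) {a : ℝ} (ha : 0 < a) :
    |iteratedDeriv n (fun x : ℝ => x⁻¹) a| = n.factorial / a ^ (n + 1) := by
  rw [iteratedDeriv_eq_iterate, iter_deriv_inv, abs_mul, abs_mul, abs_pow, abs_neg, abs_one, one_pow, one_mul,
    Nat.abs_cast]
  rw [show (-1 - (n : ℤ)) = -((n + 1 : ℕ) : ℤ) by push_cast; ring, zpow_neg, zpow_natCast, abs_inv, abs_pow,
    abs_of_pos ha, div_eq_mul_inv]

/-- **Tail bound for the quotient**: for every `i` there is `H` with `|h_k^{(i)}(a)| ≤ H a^{-i-1}` whenever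
`0 < a ≤ 2B` and `t_k² a ≥ B` (Leibniz on `(1 − G_k) · a^{-1}`). [cite: Buchholz2016, Lemma 5.1 (5.3)] -/
theorem exists_abs_iteratedDeriv_quot_le_tail (i : ℕ) : ∃ H, 0 ≤ H ∧ ∀ B : ℝ, 0 < B → ∀ L k : ℕ, ∀ a : ℝ,
    0 < a → a ≤ 2 * B → B ≤ (scaleT L k : ℝ) ^ 2 * a →
      |iteratedDeriv i (fun x => (quot B L k).eval x) a| ≤ H / a ^ (i + 1) := by
  have hG : ∀ i₁ : ℕ, ∃ C, 0 ≤ C ∧ ∀ B : ℝ, 0 < B → ∀ L k : ℕ, ∀ a : ℝ, 0 < a → a ≤ 2 * B →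
      |iteratedDeriv i₁ (lp B L k) a| ≤ C * ((scaleT L k : ℝ) ^ 2 / B) ^ i₁ *
        min 1 ((((scaleT L k : ℝ) ^ 2 * a / B))⁻¹ ^ i₁) := fun i₁ => exists_abs_iteratedDeriv_lp_le i₁ i₁
  choose C hC0 hC using hG
  -- `|∂^{i₁}(1 - G)(a)| ≤ C' a^{-i₁}` in the tail, with `C' 0 = 1`
  set C' : ℕ → ℝ := fun i₁ => if i₁ = 0 then 1 else C i₁ with hC'
  have hC'0 : ∀ i₁, 0 ≤ C' i₁ := fun i₁ => by simp only [hC']; split_ifs; exacts [zero_le_one, hC0 i₁]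
  set H : ℝ := ∑ i₁ ∈ Finset.range (i + 1), (i.choose i₁ : ℝ) * C' i₁ * (i - i₁).factorial with hH
  refine ⟨H, sum_nonneg fun i₁ _ => by have := hC'0 i₁; positivity, fun B hB L k a ha0 ha htail => ?_⟩
  -- work on the open half-line where `h = (1 - G) · (·)⁻¹`
  have hopen : IsOpen (Set.Ioi (0 : ℝ)) := isOpen_Ioi
  have hmem : a ∈ Set.Ioi (0 : ℝ) := ha0
  have heq : Set.EqOn (fun x => (quot B L k).eval x) (fun x => (1 - lp B L k x) * x⁻¹) (Set.Ioi 0) := by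
    intro x hx
    simp only
    rw [quot_eval B L k (ne_of_gt hx), div_eq_mul_inv]
  have h1 : iteratedDeriv i (fun x => (quot B L k).eval x) a = iteratedDeriv i (fun x => (1 - lp B L k x) * x⁻¹) a := by
    rw [← iteratedDerivWithin_of_isOpen hopen hmem, ← iteratedDerivWithin_of_isOpen hopen hmem]
    exact iteratedDerivWithin_congr heq hmem
  rw [h1]
  have hf : ContDiffOn ℝ i (fun x => 1 - lp B L k x) (Set.Ioi 0) :=
    (contDiff_const.sub (contDiff_lp B L k i)).contDiffOn
  have hg : ContDiffOn ℝ i (fun x : ℝ => x⁻¹) (Set.Ioi 0) :=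
    contDiffOn_inv ℝ |>.mono fun x hx => ne_of_gt hx
  have hL' := norm_iteratedFDerivWithin_mul_le (n := i) hf hg hopen.uniqueDiffOn hmem le_rfl
  rw [← Real.norm_eq_abs, ← norm_iteratedFDeriv_eq_norm_iteratedDeriv, ← iteratedFDerivWithin_of_isOpen i hopen hmem]
  refine hL'.trans ?_
  have hterm : ∀ i₁ ∈ Finset.range (i + 1), (i.choose i₁ : ℝ) *
      ‖iteratedFDerivWithin ℝ i₁ (fun x => 1 - lp B L k x) (Set.Ioi 0) a‖ *
      ‖iteratedFDerivWithin ℝ (i - i₁) (fun x : ℝ => x⁻¹) (Set.Ioi 0) a‖ ≤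
      (i.choose i₁ : ℝ) * C' i₁ * (i - i₁).factorial / a ^ (i + 1) := by
    intro i₁ hi₁
    rw [Finset.mem_range] at hi₁
    rw [iteratedFDerivWithin_of_isOpen i₁ hopen hmem, iteratedFDerivWithin_of_isOpen (i - i₁) hopen hmem,
      norm_iteratedFDeriv_eq_norm_iteratedDeriv, norm_iteratedFDeriv_eq_norm_iteratedDeriv, Real.norm_eq_abs,
      Real.norm_eq_abs, abs_iteratedDeriv_inv (i - i₁) ha0]
    -- `|∂^{i₁}(1 - G)(a)| ≤ C' i₁ / a^{i₁}`
    have hF : |iteratedDeriv i₁ (fun x => 1 - lp B L k x) a| ≤ C' i₁ / a ^ i₁ := by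
      simp only [hC']
      split_ifs with h0
      · subst h0
        rw [iteratedDeriv_zero, pow_zero, div_one]
        have h := lp_mem_Icc hB L k ha0.le (by linarith)
        rw [abs_of_nonneg (by linarith [h.2])]
        linarith [h.1]
      · have hsub : iteratedDeriv i₁ (fun x => 1 - lp B L k x) a = -iteratedDeriv i₁ (lp B L k) a := by
          rw [iteratedDeriv_const_sub (Nat.pos_of_ne_zero h0), iteratedDeriv_neg]
        rw [hsub, abs_neg]
        refine (hC i₁ B hB L k a ha0 ha).trans ?_
        set u : ℝ := (scaleT L k : ℝ) ^ 2 * a / B with hu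
        have hu1 : 1 ≤ u := by rw [hu, le_div_iff₀ hB, one_mul]; exact htail
        have hupos : 0 < u := by linarith
        have hmin : min 1 (u⁻¹ ^ i₁) = u⁻¹ ^ i₁ :=
          min_eq_right (pow_le_one₀ (by positivity) (inv_le_one_of_one_le₀ hu1))
        rw [hmin]
        have ht0 : (scaleT L k : ℝ) ≠ 0 := by
          have := two_le_scaleT L k
          exact_mod_cast (show scaleT L k ≠ 0 by omega)
        have hq : (scaleT L k : ℝ) ^ 2 / B * u⁻¹ = a⁻¹ := by
          rw [hu]; field_simp
        have : ((scaleT L k : ℝ) ^ 2 / B) ^ i₁ * u⁻¹ ^ i₁ = (a ^ i₁)⁻¹ := by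
          rw [← mul_pow, hq, inv_pow]
        rw [mul_assoc, this, div_eq_mul_inv]
    calc (i.choose i₁ : ℝ) * |iteratedDeriv i₁ (fun x => 1 - lp B L k x) a| * ((i - i₁).factorial / a ^ (i - i₁ + 1))
        ≤ (i.choose i₁ : ℝ) * (C' i₁ / a ^ i₁) * ((i - i₁).factorial / a ^ (i - i₁ + 1)) := by
          gcongr
      _ = (i.choose i₁ : ℝ) * C' i₁ * (i - i₁).factorial / (a ^ i₁ * a ^ (i - i₁ + 1)) := by
          field_simp
      _ = (i.choose i₁ : ℝ) * C' i₁ * (i - i₁).factorial / a ^ (i + 1) := by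
          rw [← pow_add, show i₁ + (i - i₁ + 1) = i + 1 by omega]
  refine (sum_le_sum hterm).trans (le_of_eq ?_)
  rw [hH, Finset.sum_div]

/-- **Symbol bound for the quotient**: for every `i` there is `H` with
`a^i |h_k^{(i)}(a)| ≤ H min(t_k²/B, 1/a)` for `B > 0`, `0 < a ≤ 2B`. [cite: Buchholz2016, Lemma 5.1 (5.3)] -/
theorem exists_abs_iteratedDeriv_quot_le (i : ℕ) : ∃ H, 0 ≤ H ∧ ∀ B : ℝ, 0 < B → ∀ L k : ℕ, ∀ a : ℝ,
    0 < a → a ≤ 2 * B →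
      a ^ i * |iteratedDeriv i (fun x => (quot B L k).eval x) a| ≤ H * min ((scaleT L k : ℝ) ^ 2 / B) (1 / a) := by
  obtain ⟨H1, hH10, hH1⟩ := exists_abs_iteratedDeriv_quot_le_bulk i
  obtain ⟨H2, hH20, hH2⟩ := exists_abs_iteratedDeriv_quot_le_tail i
  refine ⟨H1 + H2, by positivity, fun B hB L k a ha0 ha => ?_⟩
  set T : ℝ := (scaleT L k : ℝ) ^ 2 / B with hT
  have hT0 : 0 ≤ T := by positivity
  rcases le_or_gt ((scaleT L k : ℝ) ^ 2 * a) B with hbulk | htail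
  · -- bulk: `T a ≤ 1`, `min = T`
    have hTa : T * a ≤ 1 := by rw [hT, div_mul_eq_mul_div, div_le_one hB]; exact hbulk
    have hmin : min T (1 / a) = T := min_eq_left (by rw [le_div_iff₀ ha0]; exact hTa)
    rw [hmin]
    have h := hH1 B hB L k a ha0 ha
    rw [← hT] at h
    calc a ^ i * |iteratedDeriv i (fun x => (quot B L k).eval x) a| ≤ a ^ i * (H1 * T ^ (i + 1)) :=
          mul_le_mul_of_nonneg_left h (by positivity)
      _ = H1 * (T * a) ^ i * T := by rw [mul_pow, pow_succ]; ring
      _ ≤ H1 * 1 ^ i * T := by gcongr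
      _ ≤ (H1 + H2) * T := by rw [one_pow, mul_one]; nlinarith
  · -- tail: `T a ≥ 1`, `min = 1/a`
    have hTa : 1 ≤ T * a := by
      rw [hT, div_mul_eq_mul_div, le_div_iff₀ hB, one_mul]; exact htail.le
    have hmin : min T (1 / a) = 1 / a := min_eq_right (by rw [div_le_iff₀ ha0]; exact hTa)
    rw [hmin]
    have h := hH2 B hB L k a ha0 ha htail.le
    calc a ^ i * |iteratedDeriv i (fun x => (quot B L k).eval x) a| ≤ a ^ i * (H2 / a ^ (i + 1)) :=
          mul_le_mul_of_nonneg_left h (by positivity)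
      _ = H2 * (1 / a) := by rw [pow_succ]; field_simp
      _ ≤ (H1 + H2) * (1 / a) := by gcongr; linarith

end Literature.Analysis.Fourier

end
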